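import Summits.BirchSwinnertonDyer.BirchSwinnertonDyer.Theorems.KatoDescentPotSupersingularZetaBodyRefit
import Literature.NumberTheory.GaloisRepresentations.EulerSystemGaloisAction
import HarnessLib

/-!
# Tightness lemma for the rank-ONE residual (K9 `WildRankOne` 19200 / KT `TameRankOne` 19984), PART 20:
# the GROUP-RING REFIT of the tree's Kato zeta data is UNCONDITIONAL

Cell `bsd-potss` (FULL-BSD rank ≤ 1, tranche 1b), seat `bsd-potss-kmc` (descent from Kato's Λ-adic main
conjecture), generation 13, part 20; memo HOME/bsd-potss-kmc/KMC-DESCENT-MEMO-v12.md.  ROUTE-FREE (no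
route import); `--supports stmt-BirchSwinnertonDyer-19200`.  Proofs only.

WHAT THIS SHOWS.  PART 19 (`zetaBody_refit`, this namespace) proved that the refit
`(κ, Λ, z, x) ↦ (κ, Λ^θ, θ•z, x)`, `θ = σ̃ + c₀ ∈ ℤ_p[Γ_ℚ]`, preserves `Kato2004.ZetaBody` GRANTED three
displayed transport hypotheses on the classes: `hES` (`θ•z` is again an Euler system), `hur` (`θ•z` is
unramified away from `p`), `hloc` (local triviality above `p` is `Gal`-stable).  Here the three are
DISCHARGED from the generic facts of `Literature/…/GaloisRepresentations/EulerSystemGaloisAction.lean`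
(kmc g13, PART 20a): Euler systems form a `ℤ_p[Γ_ℚ]`-module (`IsEulerSystem.conj_add_smul`:
corestriction is `Γ_ℚ`-equivariant, tree `coresLe_conjMap`, and `σ̃` commutes with the Euler factors on
the abelian cyclotomic levels), and the conditions "`res_{U ∩ I_𝔓} = 0` for all `𝔓 ∣ v`" /
"`res_{U ∩ D_𝔓} = 0` for all `𝔓 ∣ p`" are `Γ_ℚ`-stable (`I_{σ̃⁻¹𝔓} = σ̃⁻¹ I_𝔓 σ̃`, `D` likewise).  Hence
(`zetaBody_refit_unconditional`): for EVERY `ZetaBody` datum `(κ, Λ, z, x)`, every `σ̃ ∈ Γ_ℚ` and every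
`c₀ ∈ ℤ_p` with `(−c₀)^{[Γ_ℚ : U]} ≠ 1` at all levels, `(κ, Λ^θ, θ•z, x)` is a `ZetaBody` datum with the
SAME constant and the SAME values; with `c₀ = p − 1`, `p ≥ 3` (`zetaBody_refit_std`) the bottom class
becomes `p • z_ℚ` (`refit_bottom`) while a single-character pin with existential exponent is carried
along (`smul_refit_levelFunctional_of_eigen`).  So memo v11 F6 — the twist-pin of memo v10 §3 / TARGET
R138 (ii) is not a closed-node specification — is now a kernel theorem with NO displayed hypothesis
beyond `ZetaBody` itself.  Nothing about BSD is asserted; 19200/19984 stay declared residuals.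

References: Rubin, *Euler systems and Kolyvagin systems* (PCMI 18, 2011) §4.1 [Rubin2011]; Rubin,
*Euler Systems* (2000) Def. 2.1.1 [Rubin2000]; Neukirch–Schmidt–Wingberg (2008) I §5 Prop. 1.5.4
[NeukirchSchmidtWingberg2008]; Serre, *Local Fields* (1979) VII §5, I §7 [SerreLocalFields1979]; Kato,
Astérisque 295 (2004) (8.1.3), §9.4, Thm. 9.7 [Kato2004Asterisque].
-/

set_option autoImplicit false
-- the D-0017 layout forces the namespace `Summit.BirchSwinnertonDyer.BirchSwinnertonDyer.…` (repeated component)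
set_option linter.dupNamespace false

noncomputable section

open scoped NumberField TensorProduct Pointwise
open Field IsDedekindDomain CongruenceSubgroup
open Literature.NumberTheory.GaloisRepresentations
open Literature.NumberTheory.EllipticCurves Literature.NumberTheory.EllipticCurves.ModularForms
open Literature.NumberTheory.EllipticCurves.Kato2004
open Literature.NumberTheory.EllipticCurves.Kato2004.EulerSystemValues Rat.HeightOneSpectrum

namespace Summit.BirchSwinnertonDyer.BirchSwinnertonDyer.Theorems.ZetaBodyRefit

section Unconditional

variable {W : WeierstrassCurve ℚ} [W.IsElliptic] {p : ℕ} [Fact p.Prime]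
  [ContinuousSMul ℤ_[p] (W.tateModule p)] [Module.Free ℤ_[p] (W.tateModule p)]
  [Module.Finite ℤ_[p] (W.tateModule p)] {N : ℕ} {f : CuspForm (Gamma0 N) 2}
  {ι : (m : ℕ) → (CyclotomicField m ℚ →+* ℂ)} {κ : ℝ}
  {Λ Λ' : ∀ (k : ℕ) (r : Finset (HeightOneSpectrum (𝓞 ℚ))),
    H1 (tateRep W p) (cycSubgroup p k r) →ₗ[ℤ_[p]] ℚ_[p] ⊗[ℚ] CyclotomicField (cycLevel p k r) ℚ}
  {c d a : ℤ} {A : ℕ}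
  {z z' : ∀ (k : ℕ) (r : (cyclotomicLevelsRat p (badPlaces c d A N)).Ideals),
    H1 (tateRep W p) (cycSubgroup p k r.1)}
  {x : ∀ (k : ℕ) (r : (cyclotomicLevelsRat p (badPlaces c d A N)).Ideals),
    CyclotomicField (cycLevel p k r.1) ℚ}
  {σ : absoluteGaloisGroup ℚ} {c₀ : ℤ_[p]}
  (hz' : ∀ (k : ℕ) (r : (cyclotomicLevelsRat p (badPlaces c d A N)).Ideals),
    z' k r = conjMap (tateRep W p).toTopRep (cycSubgroup p k r.1) σ 1 (z k r) + c₀ • z k r)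
  (hΛ' : ∀ (k : ℕ) (r : Finset (HeightOneSpectrum (𝓞 ℚ))) (y : H1 (tateRep W p) (cycSubgroup p k r)),
    Λ' k r y = ((1 : ℚ_[p]) - ((-c₀ : ℤ_[p]) : ℚ_[p]) ^ (cycSubgroup p k r).index)⁻¹ •
      ∑ i ∈ Finset.range (cycSubgroup p k r).index, (-c₀) ^ i •
        Λ k r (conjMap (tateRep W p).toTopRep (cycSubgroup p k r)
          (σ ^ ((cycSubgroup p k r).index - 1 - i)) 1 y))

include hz' in
/-- **`hES` discharged: `θ•z = σ̃•z + c₀•z` is an Euler system** whenever `z` is — Euler systems form a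
`ℤ_p[Γ_ℚ]`-module (`IsEulerSystem.conj_add_smul`: `Cor` is `Γ_ℚ`-equivariant and `σ̃` commutes with the
Euler factors on the abelian cyclotomic levels). [cite: Rubin2011, §4.1] [cite: Rubin2000, Def. 2.1.1] -/
theorem isEulerSystem_refit (h : ZetaBody W p f ι κ Λ c d a A z x) :
    IsEulerSystem (cyclotomicLevelsRat p (badPlaces c d A N)) (tateRep W p) p z' :=
  h.1.conj_add_smul (cyclotomicLevelsRat p (badPlaces c d A N)) (tateRep W p) p σ c₀ hz'

include hz' in
/-- **`hur` discharged: `θ•z` is unramified away from `p`** (clause (C2) of `ZetaBody`): restriction is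
additive, `z` is unramified, and "unramified at `v`" is `Γ_ℚ`-stable (`σ̃⁻¹(U ∩ I_𝔓)σ̃ = U ∩ I_{σ̃⁻¹𝔓}`,
`σ̃⁻¹𝔓 ∣ v`; `forall_resLe_inf_inertia_conjMap_eq_zero`).
[cite: Kato2004Asterisque, (8.1.3) (p. 180) and §8.2] [cite: SerreLocalFields1979, VII §5 and I §7] -/
theorem refit_unramified (h : ZetaBody W p f ι κ Λ c d a A z x)
    (k : ℕ) (r : (cyclotomicLevelsRat p (badPlaces c d A N)).Ideals) (v : HeightOneSpectrum (𝓞 ℚ))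
    (hv : ((primesEquiv v : Nat.Primes) : ℕ) ≠ p) :
    ∀ 𝔓 ∈ v.primesAbove,
      resLe (tateRep W p).toTopRep
          (inf_le_left : cycSubgroup p k r.1 ⊓ 𝔓.inertia (absoluteGaloisGroup ℚ) ≤ cycSubgroup p k r.1)
          1 (z' k r) = 0 := by
  obtain ⟨-, h2, -⟩ := h
  -- clause (C2) for `z`, read on the level subgroup `cycSubgroup p k r` (definitionally the level of
  -- `cyclotomicLevelsRat p S` for every `S`, `cycSubgroup_eq_level`)
  have h2' : ∀ 𝔓 ∈ v.primesAbove, resLe (tateRep W p).toTopRep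
      (inf_le_left : cycSubgroup p k r.1 ⊓ 𝔓.inertia (absoluteGaloisGroup ℚ) ≤ cycSubgroup p k r.1)
      1 (z k r) = 0 := fun 𝔓 h𝔓 ↦ h2 k r v hv 𝔓 h𝔓
  intro 𝔓 h𝔓
  rw [hz' k r, map_add, map_smul, h2' 𝔓 h𝔓, smul_zero, add_zero]
  exact forall_resLe_inf_inertia_conjMap_eq_zero (tateRep W p).toTopRep _ v σ h2' 𝔓 h𝔓

omit [Module.Free ℤ_[p] (W.tateModule p)] [Module.Finite ℤ_[p] (W.tateModule p)] in
/-- **`hloc` discharged: local triviality above `p` is `Gal`-stable** — if `res_{U ∩ D_𝔓} y = 0` for all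
`𝔓 ∣ p` then the same holds for `τ•y` (`τ⁻¹(U ∩ D_𝔓)τ = U ∩ D_{τ⁻¹𝔓}`;
`forall_resLe_inf_stabilizer_conjMap_eq_zero`). [cite: SerreLocalFields1979, VII §5 and I §7]
[cite: Kato2004Asterisque, §9.4 (p. 188)] -/
theorem local_triviality_conj_stable (k : ℕ) (r : Finset (HeightOneSpectrum (𝓞 ℚ)))
    (τ : absoluteGaloisGroup ℚ) (y : H1 (tateRep W p) (cycSubgroup p k r))
    (hy : ∀ v : HeightOneSpectrum (𝓞 ℚ), ((primesEquiv v : Nat.Primes) : ℕ) = p →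
      ∀ 𝔓 ∈ v.primesAbove,
        resLe (tateRep W p).toTopRep
            (inf_le_left : cycSubgroup p k r ⊓ MulAction.stabilizer (absoluteGaloisGroup ℚ) 𝔓 ≤
              cycSubgroup p k r) 1 y = 0) :
    ∀ v : HeightOneSpectrum (𝓞 ℚ), ((primesEquiv v : Nat.Primes) : ℕ) = p →
      ∀ 𝔓 ∈ v.primesAbove,
        resLe (tateRep W p).toTopRep
            (inf_le_left : cycSubgroup p k r ⊓ MulAction.stabilizer (absoluteGaloisGroup ℚ) 𝔓 ≤
              cycSubgroup p k r) 1 (conjMap (tateRep W p).toTopRep (cycSubgroup p k r) τ 1 y) = 0 :=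
  fun v hv ↦ forall_resLe_inf_stabilizer_conjMap_eq_zero (tateRep W p).toTopRep _ v τ (hy v hv)

include hz' hΛ' in
/-- **GROUP-RING REFIT OF THE ZETA DATA — UNCONDITIONAL (PART 20).**  Let `(κ, Λ, z, x)` satisfy
`ZetaBody W p f ι κ Λ c d a A z x`, `σ̃ ∈ Γ_ℚ`, `c₀ ∈ ℤ_p` with `(−c₀)^{n_{k,r}} ≠ 1` in `ℚ_p` at every
level (`n_{k,r} = [Γ_ℚ : Gal(ℚ̄/ℚ(μ_m))]`; `c₀ = p − 1` is admissible for `p ≥ 3`, `one_sub_neg_pow_ne_zero`),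
`z' = θ•z = σ̃•z + c₀•z` (`hz'`) and `Λ' = Λ^θ = Λ ∘ θ⁻¹` (`hΛ'`).  Then `(κ, Λ^θ, θ•z, x)` satisfies
`ZetaBody`: SAME `κ`, SAME values `x` — now with NO further hypothesis (PART 19's `zetaBody_refit` with
`hES`/`hur`/`hloc` discharged by `isEulerSystem_refit`, `refit_unramified`, `local_triviality_conj_stable`).
Consequence (memo v11 F6, v12): any node on `ZetaBody` data that a refit moves — e.g. the twist-pin node
`pos(z_ℚ) − v_p(t_χ) + a` of memo v10 §3 (moves by `v_p(1 + c₀) − v_p(χ(σ̃) + c₀)`, `refit_bottom`,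
`smul_refit_levelFunctional_of_eigen`) — is FALSE as a `∀`-statement over `ZetaBody` data.
[cite: Kato2004Asterisque, (8.1.3) (p. 180), §9.4 (p. 188), Thm. 9.7 (p. 189), Thm. 6.6 (1) (p. 163)]
[cite: Rubin2011, §4.1] -/
theorem zetaBody_refit_unconditional
    (hc : ∀ (k : ℕ) (r : Finset (HeightOneSpectrum (𝓞 ℚ))),
      (1 : ℚ_[p]) - ((-c₀ : ℤ_[p]) : ℚ_[p]) ^ (cycSubgroup p k r).index ≠ 0)
    (h : ZetaBody W p f ι κ Λ c d a A z x) : ZetaBody W p f ι κ Λ' c d a A z' x :=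
  zetaBody_refit hz' hΛ' hc h (isEulerSystem_refit hz' h) (refit_unramified hz' h)
    (fun k r τ y hy ↦ local_triviality_conj_stable k r τ y hy)

include hz' hΛ' in
/-- **The standard refit `θ = σ̃ + (p − 1)`, `p ≥ 3`:** for every `ZetaBody` datum `(κ, Λ, z, x)` and every
`σ̃ ∈ Γ_ℚ`, `(κ, Λ^θ, θ•z, x)` is again a `ZetaBody` datum, and its bottom class is `p • z_ℚ`
(`refit_bottom`: `1 + c₀ = p`).  So the `p`-divisibility position of the bottom class is NOT an invariant
of `ZetaBody` data with fixed `(κ, x)` — while on a `χ`-eigenclass of `σ̃` with `χ(σ̃) = −1` the level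
functional is only rescaled by the unit `p − 2` (`smul_refit_levelFunctional_of_eigen`).
[cite: Kato2004Asterisque, (8.1.3) (p. 180), §9.4 (p. 188), Thm. 9.7 (p. 189)] [cite: Rubin2011, §4.1] -/
theorem zetaBody_refit_std (hp : 3 ≤ p) (hc₀ : c₀ = (p : ℤ_[p]) - 1)
    (h : ZetaBody W p f ι κ Λ c d a A z x) :
    ZetaBody W p f ι κ Λ' c d a A z' x ∧
      z' 0 (cyclotomicLevelsRat p (badPlaces c d A N)).idealOne =
        (p : ℤ_[p]) • z 0 (cyclotomicLevelsRat p (badPlaces c d A N)).idealOne := by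
  refine ⟨zetaBody_refit_unconditional hz' hΛ' (fun k r ↦ ?_) h, ?_⟩
  · rw [hc₀]
    exact one_sub_neg_pow_ne_zero hp (index_cycSubgroup_ne_zero k r)
  · rw [refit_bottom hz', hc₀, add_sub_cancel]

end Unconditional

end Summit.BirchSwinnertonDyer.BirchSwinnertonDyer.Theorems.ZetaBodyRefit

end
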